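import Literature.AlgebraicGeometry.Modules.UnitCocyclePullback
import Summits.HodgeConjecture.HodgeConjecture.Theorems.PadicSemiregularLiftFormalVectorBundlesAlgebraizeThickenings
import Summits.HodgeConjecture.HodgeConjecture.Theorems.FormalLiftingFromClassLifting.Negative.ProClassCorrectionStubs

/-!
# `FormalLiftingFromClassLifting` (stmt-HodgeConjecture-13825) · line `IdeatorFiveSketch` ·
# Čech unit cocycles on the `p`-adic thickenings presented on affine opens of `𝒳`

Support file for stub S4 `stub_picKernelLift` ((2_Pic)) of the weight-one-first skeleton (lead
prover-line-stmt-HodgeConjecture-13825-c1-0). For a `W(k)`-scheme `𝒳` with thickenings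
`ι_n : X_n = 𝒳 ⊗ W/pⁿ ↪ 𝒳`, a *datum* is a point-indexed family of opens `A_x ∋ x` of `𝒳` and
sections `G_{xy} ∈ Γ(𝒳, A_x ∩ A_y)`; it *presents a cocycle on `X_n`* when the `ι_n`-images satisfy
the cocycle identity and `G_{xx} ↦ 1`. We prove: such a datum defines a unit cocycle on `X_n`
(`exists_cocycle_of_datum`), the class on `X_m` of a datum valid on `X_n` (`m ≤ n`) is the pull-back
of its class on `X_n` (`pullback_mk_eq_mk_of_datum`), two data related by units define the same
class (`mk_eq_mk_of_units`); and the small facts about the tower used to build data: points of the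
thickenings, sections over opens missing the special fibre, kernels and surjectivity of the
restrictions to `X_n` and to the special fibre on affine opens, affine intersections. Everything is
proved; no definitions.
-/

set_option linter.dupNamespace false

namespace Summit.HodgeConjecture.HodgeConjecture.Theorems.FormalLiftingFromClassLifting.WeightOne

open CategoryTheory AlgebraicGeometry Limits Opposite TopologicalSpace
open Literature.AlgebraicGeometry Literature.AlgebraicGeometry.Motives
open Literature.AlgebraicGeometry.Motives.WittScheme
open Literature.AlgebraicGeometry.Modules (CechPic UnitCocycle)
open Summit.HodgeConjecture.HodgeConjecture.Theorems.FormalVectorBundlesAlgebraize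
  (thickeningι_cutOut mul_p_pow_injective_sections isClosedImmersion_thickeningι range_thickeningι)

noncomputable section

section Datum

variable {p : ℕ} [Fact p.Prime] {k : Type} [Field k] (𝒳 : SchemeOver (WittVector p k))

/-- Restricting along `appLE` from a smaller open of `𝒳`: `ι.appLE U V e y = ι.appLE U' V e' (y|_{U'})`
for `U' ≤ U` (Mathlib `Scheme.Hom.map_appLE`, elementwise). -/
theorem appLE_res_apply {X Y : Scheme.{0}} (f : X ⟶ Y) {U U' : Y.Opens} (i : U' ≤ U) (V : X.Opens)
    (e' : V ≤ f ⁻¹ᵁ U') (y : Γ(Y, U)) :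
    f.appLE U V (e'.trans ((Opens.map f.base).map (homOfLE i)).le) y =
      f.appLE U' V e' (Y.presheaf.map (homOfLE i).op y) := by
  rw [← CategoryTheory.comp_apply, Scheme.Hom.map_appLE]

/-- `appLE U V e = (appLE U V₀ e₀)|_V` for `V ≤ V₀` (Mathlib `Scheme.Hom.appLE_map`, elementwise). -/
theorem appLE_eq_map_appLE {X Y : Scheme.{0}} (f : X ⟶ Y) (U : Y.Opens) {V V₀ : X.Opens} (i : V ≤ V₀)
    (e₀ : V₀ ≤ f ⁻¹ᵁ U) (y : Γ(Y, U)) :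
    f.appLE U V (i.trans e₀) y = X.presheaf.map (homOfLE i).op (f.appLE U V₀ e₀ y) := by
  rw [← CategoryTheory.comp_apply, Scheme.Hom.appLE_map]

/-- `appLE` of equal morphisms. -/
theorem appLE_congr_hom {X Y : Scheme.{0}} {f g : X ⟶ Y} (hfg : f = g) (U : Y.Opens) (V : X.Opens)
    (e : V ≤ f ⁻¹ᵁ U) : f.appLE U V e = g.appLE U V (hfg ▸ e) := by
  subst hfg
  rfl

/-- **A datum presenting a cocycle on `X_n` defines a unit cocycle on `X_n`**: opens
`ι_n⁻¹ A_{ι_n z}` and transition functions `ι_n^♯ G_{ι_n z, ι_n z'}`. [folklore] -/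
theorem exists_cocycle_of_datum (n : ℕ) (A : 𝒳.left → 𝒳.left.Opens) (hA : ∀ x, x ∈ A x)
    (G : ∀ x y : 𝒳.left, Γ(𝒳.left, A x ⊓ A y))
    (hmul : ∀ x y z : 𝒳.left,
      (thickeningι 𝒳 n).app (A x ⊓ A y ⊓ A z)
        (𝒳.left.presheaf.map (homOfLE inf_le_left).op (G x y) *
          𝒳.left.presheaf.map
            (homOfLE (le_inf (inf_le_left.trans inf_le_right) inf_le_right)).op (G y z)) =
      (thickeningι 𝒳 n).app (A x ⊓ A y ⊓ A z)
        (𝒳.left.presheaf.map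
          (homOfLE (le_inf (inf_le_left.trans inf_le_left) inf_le_right)).op (G x z)))
    (hself : ∀ x : 𝒳.left, (thickeningι 𝒳 n).app (A x ⊓ A x) (G x x) = 1) :
    ∃ (C : UnitCocycle (thickening 𝒳 n).left)
      (hU : ∀ z, C.U z = (thickeningι 𝒳 n) ⁻¹ᵁ A ((thickeningι 𝒳 n).base z)),
      ∀ (z z' : (thickening 𝒳 n).left) (V : (thickening 𝒳 n).left.Opens)
        (hz : V ≤ C.U z) (hz' : V ≤ C.U z'),
        C.g z z' V hz hz' = (thickeningι 𝒳 n).appLE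
          (A ((thickeningι 𝒳 n).base z) ⊓ A ((thickeningι 𝒳 n).base z')) V
          (UnitCocycle.le_preimage_inf _ (hz.trans (hU z).le) (hz'.trans (hU z').le))
          (G ((thickeningι 𝒳 n).base z) ((thickeningι 𝒳 n).base z')) := by
  set ι := thickeningι 𝒳 n with hι
  refine ⟨{ U := fun z => ι ⁻¹ᵁ A (ι.base z)
            mem := fun z => hA _
            g := fun z z' V hz hz' => ι.appLE (A (ι.base z) ⊓ A (ι.base z')) V
              (UnitCocycle.le_preimage_inf _ hz hz') (G (ι.base z) (ι.base z'))
            map_g := fun z z' V V' hz hz' i => by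
              change ((ι.appLE _ V _) ≫ (thickening 𝒳 n).left.presheaf.map (homOfLE i).op) _ = _
              rw [Scheme.Hom.appLE_map]
            g_mul := fun z z' z'' V hz hz' hz'' => ?_
            g_self := fun z V hz => ?_ }, fun z => rfl, fun z z' V hz hz' => rfl⟩
  · -- move everything to the triple intersection
    have e' : V ≤ ι ⁻¹ᵁ (A (ι.base z) ⊓ A (ι.base z') ⊓ A (ι.base z'')) :=
      UnitCocycle.le_preimage_inf _ (UnitCocycle.le_preimage_inf _ hz hz') hz''
    rw [show ι.appLE (A (ι.base z) ⊓ A (ι.base z')) V (UnitCocycle.le_preimage_inf _ hz hz')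
          (G (ι.base z) (ι.base z')) = ι.appLE _ V e' (𝒳.left.presheaf.map (homOfLE inf_le_left).op
          (G (ι.base z) (ι.base z'))) from appLE_res_apply ι inf_le_left V e' _,
      show ι.appLE (A (ι.base z') ⊓ A (ι.base z'')) V (UnitCocycle.le_preimage_inf _ hz' hz'')
          (G (ι.base z') (ι.base z'')) = ι.appLE _ V e' (𝒳.left.presheaf.map
          (homOfLE (le_inf (inf_le_left.trans inf_le_right) inf_le_right)).op
          (G (ι.base z') (ι.base z''))) from appLE_res_apply ι _ V e' _,
      show ι.appLE (A (ι.base z) ⊓ A (ι.base z'')) V (UnitCocycle.le_preimage_inf _ hz hz'')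
          (G (ι.base z) (ι.base z'')) = ι.appLE _ V e' (𝒳.left.presheaf.map
          (homOfLE (le_inf (inf_le_left.trans inf_le_left) inf_le_right)).op
          (G (ι.base z) (ι.base z''))) from appLE_res_apply ι _ V e' _]
    rw [← map_mul]
    change (ι.app _ ≫ (thickening 𝒳 n).left.presheaf.map (homOfLE e').op) _ =
      (ι.app _ ≫ (thickening 𝒳 n).left.presheaf.map (homOfLE e').op) _
    rw [CategoryTheory.comp_apply, CategoryTheory.comp_apply, hmul]
  · have e' : V ≤ ι ⁻¹ᵁ (A (ι.base z) ⊓ A (ι.base z)) := UnitCocycle.le_preimage_inf _ hz hz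
    change (ι.app _ ≫ (thickening 𝒳 n).left.presheaf.map (homOfLE e').op) _ = 1
    rw [CategoryTheory.comp_apply, hself, map_one]

/-- Values of a datum read through `appLE` only depend on the indexing points (transport of the
point equality `ι_n (t z) = ι_m z`). -/
theorem appLE_datum_congr {X : Scheme.{0}} (f : X ⟶ 𝒳.left) (A : 𝒳.left → 𝒳.left.Opens)
    (G : ∀ x y : 𝒳.left, Γ(𝒳.left, A x ⊓ A y)) {x₁ x₂ y₁ y₂ : 𝒳.left} (hx : x₁ = x₂) (hy : y₁ = y₂)
    (V : X.Opens) (e₁ : V ≤ f ⁻¹ᵁ (A x₁ ⊓ A y₁)) (e₂ : V ≤ f ⁻¹ᵁ (A x₂ ⊓ A y₂)) :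
    f.appLE (A x₁ ⊓ A y₁) V e₁ (G x₁ y₁) = f.appLE (A x₂ ⊓ A y₂) V e₂ (G x₂ y₂) := by
  subst hx; subst hy; rfl

/-- `ι_n (t z) = ι_m z` for the transition `t : X_m → X_n`. -/
theorem thickeningι_base_thickeningMap {m n : ℕ} (h : m ≤ n) (z : (thickening 𝒳 m).left) :
    (thickeningι 𝒳 n).base ((thickeningMap 𝒳 h).base z) = (thickeningι 𝒳 m).base z :=
  congrArg (fun f => f.base z) (thickeningMap_ι 𝒳 h)

/-- **The class on `X_m` of a datum is the pull-back of its class on `X_n`** (`m ≤ n`): for cocycles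
`C'` on `X_n` and `C` on `X_m` both built from the datum `(A, G)` as in `exists_cocycle_of_datum`,
`t^*[C'] = [C]`. [folklore] -/
theorem pullback_mk_eq_mk_of_datum {m n : ℕ} (h : m ≤ n) (A : 𝒳.left → 𝒳.left.Opens)
    (G : ∀ x y : 𝒳.left, Γ(𝒳.left, A x ⊓ A y))
    (C' : UnitCocycle (thickening 𝒳 n).left)
    (hU' : ∀ z, C'.U z = (thickeningι 𝒳 n) ⁻¹ᵁ A ((thickeningι 𝒳 n).base z))
    (hg' : ∀ (z z' : (thickening 𝒳 n).left) (V : (thickening 𝒳 n).left.Opens)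
        (hz : V ≤ C'.U z) (hz' : V ≤ C'.U z'),
        C'.g z z' V hz hz' = (thickeningι 𝒳 n).appLE
          (A ((thickeningι 𝒳 n).base z) ⊓ A ((thickeningι 𝒳 n).base z')) V
          (UnitCocycle.le_preimage_inf _ (hz.trans (hU' z).le) (hz'.trans (hU' z').le))
          (G ((thickeningι 𝒳 n).base z) ((thickeningι 𝒳 n).base z')))
    (C : UnitCocycle (thickening 𝒳 m).left)
    (hU : ∀ z, C.U z = (thickeningι 𝒳 m) ⁻¹ᵁ A ((thickeningι 𝒳 m).base z))
    (hg : ∀ (z z' : (thickening 𝒳 m).left) (V : (thickening 𝒳 m).left.Opens)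
        (hz : V ≤ C.U z) (hz' : V ≤ C.U z'),
        C.g z z' V hz hz' = (thickeningι 𝒳 m).appLE
          (A ((thickeningι 𝒳 m).base z) ⊓ A ((thickeningι 𝒳 m).base z')) V
          (UnitCocycle.le_preimage_inf _ (hz.trans (hU z).le) (hz'.trans (hU z').le))
          (G ((thickeningι 𝒳 m).base z) ((thickeningι 𝒳 m).base z'))) :
    CechPic.pullback (thickeningMap 𝒳 h) (CechPic.mk C') = CechPic.mk C := by
  set t := thickeningMap 𝒳 h with ht
  rw [CechPic.pullback_mk]
  refine CechPic.sound (UnitCocycle.equiv_of_eq _ _ (fun z => C.U z ⊓ t ⁻¹ᵁ C'.U (t.base z))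
    (fun z => ⟨C.mem z, C'.mem _⟩) (fun z => inf_le_right) (fun z => inf_le_left) fun z z' V hz hz' => ?_)
  rw [hg]
  change _ = t.appLE (C'.U (t.base z) ⊓ C'.U (t.base z')) V
    (UnitCocycle.le_preimage_inf t (hz.trans inf_le_right) (hz'.trans inf_le_right))
    (C'.g (t.base z) (t.base z') _ inf_le_left inf_le_right)
  rw [hg', ← CategoryTheory.comp_apply, Scheme.Hom.appLE_comp_appLE,
    appLE_congr_hom (thickeningMap_ι 𝒳 h)]
  exact appLE_datum_congr 𝒳 (thickeningι 𝒳 m) A G (thickeningι_base_thickeningMap 𝒳 h z).symm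
    (thickeningι_base_thickeningMap 𝒳 h z').symm V _ _

/-- **Two data related by units define the same class.** If `(A', G')` refines `(A, G)`
(`A'_x ≤ A_x`) and units `μ_x ∈ Γ(𝒳, A'_x)` (units on `X_n`) satisfy `G_{xy} μ_y = μ_x G'_{xy}` on
`X_n`, then the cocycles built from the two data have the same class in `Ȟ¹(X_n, 𝒪^×)`. [folklore] -/
theorem mk_eq_mk_of_units (n : ℕ) (A A' : 𝒳.left → 𝒳.left.Opens) (hle : ∀ x, A' x ≤ A x)
    (G : ∀ x y : 𝒳.left, Γ(𝒳.left, A x ⊓ A y)) (G' : ∀ x y : 𝒳.left, Γ(𝒳.left, A' x ⊓ A' y))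
    (C : UnitCocycle (thickening 𝒳 n).left)
    (hU : ∀ z, C.U z = (thickeningι 𝒳 n) ⁻¹ᵁ A ((thickeningι 𝒳 n).base z))
    (hg : ∀ (z z' : (thickening 𝒳 n).left) (V : (thickening 𝒳 n).left.Opens)
        (hz : V ≤ C.U z) (hz' : V ≤ C.U z'),
        C.g z z' V hz hz' = (thickeningι 𝒳 n).appLE
          (A ((thickeningι 𝒳 n).base z) ⊓ A ((thickeningι 𝒳 n).base z')) V
          (UnitCocycle.le_preimage_inf _ (hz.trans (hU z).le) (hz'.trans (hU z').le))
          (G ((thickeningι 𝒳 n).base z) ((thickeningι 𝒳 n).base z')))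
    (C' : UnitCocycle (thickening 𝒳 n).left)
    (hU' : ∀ z, C'.U z = (thickeningι 𝒳 n) ⁻¹ᵁ A' ((thickeningι 𝒳 n).base z))
    (hg' : ∀ (z z' : (thickening 𝒳 n).left) (V : (thickening 𝒳 n).left.Opens)
        (hz : V ≤ C'.U z) (hz' : V ≤ C'.U z'),
        C'.g z z' V hz hz' = (thickeningι 𝒳 n).appLE
          (A' ((thickeningι 𝒳 n).base z) ⊓ A' ((thickeningι 𝒳 n).base z')) V
          (UnitCocycle.le_preimage_inf _ (hz.trans (hU' z).le) (hz'.trans (hU' z').le))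
          (G' ((thickeningι 𝒳 n).base z) ((thickeningι 𝒳 n).base z')))
    (μ : ∀ x : 𝒳.left, Γ(𝒳.left, A' x))
    (hμ : ∀ x, IsUnit ((thickeningι 𝒳 n).app (A' x) (μ x)))
    (hrel : ∀ x y : 𝒳.left,
      (thickeningι 𝒳 n).app (A' x ⊓ A' y)
        (𝒳.left.presheaf.map (homOfLE (inf_le_inf (hle x) (hle y))).op (G x y) *
          𝒳.left.presheaf.map (homOfLE inf_le_right).op (μ y)) =
      (thickeningι 𝒳 n).app (A' x ⊓ A' y)
        (𝒳.left.presheaf.map (homOfLE inf_le_left).op (μ x) * G' x y)) :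
    CechPic.mk C = CechPic.mk C' := by
  set ι := thickeningι 𝒳 n with hι
  symm
  refine CechPic.sound ⟨{
    W := fun z => ι ⁻¹ᵁ A' (ι.base z)
    mem := fun z => by
      have hz := C'.mem z
      rw [hU' z] at hz
      exact hz
    le := fun z => (hU' z).ge
    le' := fun z => by rw [hU z]; exact fun q hq => hle _ hq
    lam := fun z V hz => ι.appLE (A' (ι.base z)) V hz (μ (ι.base z))
    inv := fun z V hz => (thickening 𝒳 n).left.presheaf.map (homOfLE hz).op
      (↑(hμ (ι.base z)).unit⁻¹ : Γ((thickening 𝒳 n).left, ι ⁻¹ᵁ A' (ι.base z)))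
    map_lam := fun z V V' hz i => by
      change (ι.appLE _ V hz ≫ (thickening 𝒳 n).left.presheaf.map (homOfLE i).op) _ = _
      rw [Scheme.Hom.appLE_map]
    lam_mul_inv := fun z V hz => by
      change ((ι.app _ ≫ (thickening 𝒳 n).left.presheaf.map (homOfLE hz).op) (μ (ι.base z))) * _ = 1
      rw [CategoryTheory.comp_apply, ← map_mul, IsUnit.mul_val_inv, map_one]
    rel := fun z z' V hz hz' => ?_ }⟩
  · rw [hg, hg']
    have e' : V ≤ ι ⁻¹ᵁ (A' (ι.base z) ⊓ A' (ι.base z')) := UnitCocycle.le_preimage_inf _ hz hz'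
    rw [show ι.appLE (A (ι.base z) ⊓ A (ι.base z')) V _ (G (ι.base z) (ι.base z')) =
          ι.appLE _ V e' (𝒳.left.presheaf.map (homOfLE (inf_le_inf (hle _) (hle _))).op
            (G (ι.base z) (ι.base z'))) from appLE_res_apply ι _ V e' _,
      show ι.appLE (A' (ι.base z')) V hz' (μ (ι.base z')) =
          ι.appLE _ V e' (𝒳.left.presheaf.map (homOfLE inf_le_right).op (μ (ι.base z')))
        from appLE_res_apply ι _ V e' _,
      show ι.appLE (A' (ι.base z)) V hz (μ (ι.base z)) =
          ι.appLE _ V e' (𝒳.left.presheaf.map (homOfLE inf_le_left).op (μ (ι.base z)))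
        from appLE_res_apply ι _ V e' _]
    rw [← map_mul, ← map_mul]
    change (ι.app _ ≫ (thickening 𝒳 n).left.presheaf.map (homOfLE e').op) _ =
      (ι.app _ ≫ (thickening 𝒳 n).left.presheaf.map (homOfLE e').op) _
    rw [CategoryTheory.comp_apply, CategoryTheory.comp_apply, hrel]


end Datum

section TowerFacts

variable {p : ℕ} [Fact p.Prime] {k : Type} [Field k] (𝒳 : SchemeOver (WittVector p k))

/-- Points of `X_{n+1}` come from the special fibre: `X_k → X_{n+1}` is surjective (both have image
the special fibre of `𝒳`, and `X_{n+1} ↪ 𝒳` is injective). [folklore] -/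
theorem surjective_specialFibreToThickening_base [CharP k p] [PerfectRing k p] (n : ℕ) :
    Function.Surjective (specialFibreToThickening 𝒳 n).base := by
  intro z
  have h1 : (thickeningι 𝒳 (n + 1)).base z ∈ Set.range (thickeningι 𝒳 1).base := by
    rw [range_thickeningι 𝒳 one_ne_zero, ← range_thickeningι 𝒳 (Nat.succ_ne_zero n)]
    exact ⟨z, rfl⟩
  obtain ⟨z₁, hz₁⟩ := h1
  haveI := Negative.isIso_specialFibreToThickening_zero' 𝒳
  obtain ⟨z₀, rfl⟩ := (Scheme.homeoOfIso (asIso (specialFibreToThickening 𝒳 0))).surjective z₁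
  refine ⟨z₀, ?_⟩
  have h01 : 0 + 1 ≤ n + 1 := by omega
  haveI := isClosedImmersion_thickeningι 𝒳 (n + 1)
  apply (thickeningι 𝒳 (n + 1)).isClosedEmbedding.injective
  have hcomp := congrArg (fun f => (thickeningι 𝒳 (n + 1)).base (f.base z₀))
    (Negative.specialFibreToThickening_comp_thickeningMap 𝒳 h01)
  dsimp only at hcomp
  rw [← hcomp, Scheme.Hom.comp_apply, thickeningι_base_thickeningMap]
  rw [Scheme.coe_homeoOfIso] at hz₁
  exact hz₁

/-- Sections of `X_n` over the preimage of an open of `𝒳` missing the special fibre are trivial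
(the preimage is empty). [folklore] -/
theorem subsingleton_sections_preimage (n : ℕ) (U : 𝒳.left.Opens)
    (hU : ∀ q ∈ U, q ∉ Set.range (thickeningι 𝒳 n).base) :
    Subsingleton Γ((thickening 𝒳 n).left, (thickeningι 𝒳 n) ⁻¹ᵁ U) := by
  have hbot : (thickeningι 𝒳 n) ⁻¹ᵁ U = ⊥ := by
    ext z
    simp only [Opens.map_coe, Set.mem_preimage, SetLike.mem_coe, Opens.coe_bot,
      Set.mem_empty_iff_false, iff_false]
    exact fun hz => hU _ hz ⟨z, rfl⟩
  exact CommRingCat.subsingleton_of_isTerminal ((thickening 𝒳 n).left.sheaf.isTerminalOfEqEmpty hbot)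

/-- Intersections of affine opens of `𝒳` are affine when `𝒳` is separated over `Spec W`. [folklore] -/
theorem isAffineOpen_inf [IsSeparated 𝒳.hom] {U V : 𝒳.left.Opens} (hU : IsAffineOpen U)
    (hV : IsAffineOpen V) : IsAffineOpen (U ⊓ V) :=
  isAffineHom_diagonal_iff.mp (inferInstance : IsAffineHom (pullback.diagonal 𝒳.hom)) ⊤
    (isAffineOpen_top _) U (by simp) V (by simp) hU hV

/-- The preimage in `X_n` of an affine open of `𝒳` is affine (`X_n ↪ 𝒳` is affine). [folklore] -/
theorem isAffineOpen_preimage_thickeningι (n : ℕ) {U : 𝒳.left.Opens} (hU : IsAffineOpen U) :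
    IsAffineOpen ((thickeningι 𝒳 n) ⁻¹ᵁ U) := by
  haveI := isClosedImmersion_thickeningι 𝒳 n
  exact hU.preimage _

/-- `1 + p c` is a unit on `X_n` (`p` is nilpotent there). [folklore] -/
theorem isUnit_one_add_p_mul (n : ℕ) {U : (thickening 𝒳 n).left.Opens}
    (c : Γ((thickening 𝒳 n).left, U)) : IsUnit (1 + (p : Γ((thickening 𝒳 n).left, U)) * c) := by
  refine IsNilpotent.isUnit_one_add ⟨n, ?_⟩
  rw [mul_pow, ← Nat.cast_pow, PadicPridhamSemiregularity.natCast_pow_eq_zero_thickening, zero_mul]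

/-- **Kernel of the restriction to the special fibre** on an affine open of `X_{n+1}`: a section
dying on `X_k` is a multiple of `p` (`k` perfect). [folklore] -/
theorem exists_eq_p_mul_of_app_specialFibreToThickening_eq_zero [CharP k p] [PerfectRing k p]
    (n : ℕ) {V : (thickening 𝒳 (n + 1)).left.Opens} (hV : IsAffineOpen V)
    (y : Γ((thickening 𝒳 (n + 1)).left, V)) (hy : (specialFibreToThickening 𝒳 n).app V y = 0) :
    ∃ c : Γ((thickening 𝒳 (n + 1)).left, V), y = (p : Γ((thickening 𝒳 (n + 1)).left, V)) * c := by
  have hy' : y ∈ RingHom.ker ((specialFibreToThickening 𝒳 n).app V).hom := hy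
  obtain ⟨c, hc⟩ := Ideal.mem_span_singleton'.mp
    (PadicPridhamSemiregularity.ker_app_specialFibreToThickening_le 𝒳 n hV hy')
  exact ⟨c, by rw [← hc, mul_comm, pow_one]⟩

/-- The restriction to the special fibre is surjective on affine opens of `X_{n+1}`
(`X_k ↪ X_{n+1}` is a closed immersion). [folklore] -/
theorem app_specialFibreToThickening_surjective [CharP k p] (n : ℕ)
    {V : (thickening 𝒳 (n + 1)).left.Opens} (hV : IsAffineOpen V) :
    Function.Surjective ((specialFibreToThickening 𝒳 n).app V) := by
  haveI := PadicPridhamSemiregularity.isClosedImmersion_specialFibreToThickening' 𝒳 n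
  exact (specialFibreToThickening 𝒳 n).app_surjective V hV

/-- **Kernel of the restriction from `𝒳` to `X_n`** on an affine open, multiplicative form:
a function on `𝒳` dying on `X_n` is `pⁿ` times a function. [folklore] -/
theorem exists_eq_pow_mul_of_app_thickeningι_eq_zero (n : ℕ) {U : 𝒳.left.Opens}
    (hU : IsAffineOpen U) (r : Γ(𝒳.left, U)) (hr : (thickeningι 𝒳 n).app U r = 0) :
    ∃ c : Γ(𝒳.left, U), r = (p : Γ(𝒳.left, U)) ^ n * c := by
  obtain ⟨c, hc⟩ := ((thickeningι_cutOut 𝒳 n hU).2 r).mp hr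
  exact ⟨c, by rw [hc, map_natCast, Nat.cast_pow]⟩

/-- `pⁿ` times anything dies on `X_n`. [folklore] -/
theorem app_thickeningι_pow_mul (n : ℕ) (U : 𝒳.left.Opens) (c : Γ(𝒳.left, U)) :
    (thickeningι 𝒳 n).app U ((p : Γ(𝒳.left, U)) ^ n * c) = 0 := by
  rw [map_mul, map_pow, map_natCast, ← Nat.cast_pow,
    PadicPridhamSemiregularity.natCast_pow_eq_zero_thickening, zero_mul]

end TowerFacts

section RegisteredStub

/-- **Registered stub `stub_towerDatumCocycle` (T) of the weight-one-first skeleton** of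
`PadicSemiregularLift.FormalLiftingFromClassLifting` (line `IdeatorFiveSketch`): a datum presenting a
cocycle on `X_n` defines a unit cocycle on `X_n` with the prescribed opens and transition functions
(closed form of `exists_cocycle_of_datum`). -/
theorem stub_towerDatumCocycle :
    ∀ (p : ℕ) [Fact p.Prime] (k : Type) [Field k] (𝒳 : SchemeOver (WittVector p k)) (n : ℕ)
      (A : 𝒳.left → 𝒳.left.Opens), (∀ x, x ∈ A x) →
      ∀ (G : ∀ x y : 𝒳.left, Γ(𝒳.left, A x ⊓ A y)),
      (∀ x y z : 𝒳.left,
        (thickeningι 𝒳 n).app (A x ⊓ A y ⊓ A z)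
          (𝒳.left.presheaf.map (homOfLE inf_le_left).op (G x y) *
            𝒳.left.presheaf.map
              (homOfLE (le_inf (inf_le_left.trans inf_le_right) inf_le_right)).op (G y z)) =
        (thickeningι 𝒳 n).app (A x ⊓ A y ⊓ A z)
          (𝒳.left.presheaf.map
            (homOfLE (le_inf (inf_le_left.trans inf_le_left) inf_le_right)).op (G x z))) →
      (∀ x : 𝒳.left, (thickeningι 𝒳 n).app (A x ⊓ A x) (G x x) = 1) →
      ∃ (C : UnitCocycle (thickening 𝒳 n).left)
        (hU : ∀ z, C.U z = (thickeningι 𝒳 n) ⁻¹ᵁ A ((thickeningι 𝒳 n).base z)),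
        ∀ (z z' : (thickening 𝒳 n).left) (V : (thickening 𝒳 n).left.Opens)
          (hz : V ≤ C.U z) (hz' : V ≤ C.U z'),
          C.g z z' V hz hz' = (thickeningι 𝒳 n).appLE
            (A ((thickeningι 𝒳 n).base z) ⊓ A ((thickeningι 𝒳 n).base z')) V
            (UnitCocycle.le_preimage_inf _ (hz.trans (hU z).le) (hz'.trans (hU z').le))
            (G ((thickeningι 𝒳 n).base z) ((thickeningι 𝒳 n).base z')) := by
  intro p _ k _ 𝒳 n A hA G hmul hself
  exact exists_cocycle_of_datum 𝒳 n A hA G hmul hself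

end RegisteredStub

end

end Summit.HodgeConjecture.HodgeConjecture.Theorems.FormalLiftingFromClassLifting.WeightOne
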